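import Mathlib.Analysis.Real.Sqrt
import Mathlib.Algebra.Order.BigOperators.Ring.Finset
import Literature.Computability.Complexity.BlockSensitivity
import HarnessLib

/-!
# The certificate-complexity ceiling of the spectral adversary method

Špalek–Szegedy, *All quantum adversary methods are equivalent*, Theory of Computing 2 (2006),
**Thm. 3.2 / Cor. 3.3**: «all quantum adversary lower bounds are at most
`min(√(C₀(f) n), √(C₁(f) n))` for partial Boolean functions and `√(C₀(f) C₁(f))` for total
Boolean `f`»; Høyer–Špalek, *Lower bounds on quantum query complexity*, Bull. EATCS 87 (2005)
§6 **Lemma 6** ([LM04, Zhang05, ŠS06]): «the spectral adversary lower bound `Adv(F)` is at most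
`min{√(C₀(F)N), √(C₁(F)N)}`. If `F` is total, the method is limited by `√(C₀(F)C₁(F))`.»
Here `Adv(F) = max_Γ λ(Γ)/max_i λ(Γ_i)` over the spectral adversary matrices of `F`
(«`Γ` symmetric, non-negative, `Γ[x,y] = 0` whenever `F(x) = F(y)`», `Γ_i[x,y] = Γ[x,y]` if
`x_i ≠ y_i` and `0` otherwise [HoyerSpalek2005, §3–§4]) and `C_x`, `C₀`, `C₁`, `C` are the
certificate complexities of `Complexity/BlockSensitivity.lean` (`IsCertificate`,
`certificateComplexityAt`, `oneCertificateComplexity`, `certificateComplexity`; [BealsEtAl2001]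
Def. 5.1).

We type the ceiling FOR THE SPECTRAL FORMULATION, model-free, in the Rayleigh-quotient
vocabulary of the tree's `SpectralAdversary.lean` (no matrix norms are used or developed): for
every `Γ ≥ 0` vanishing on pairs with equal `f`-value, every real `Λ ≥ 0` bounding the quadratic
forms of all `Γ_i` on nonnegative vectors (`∑_{x,y : x_i ≠ y_i} Γ[x,y] v_x v_y ≤ Λ ∑_x v_x²`; for
a symmetric nonnegative matrix this says `Λ ≥ max_i λ(Γ_i)` by Perron–Frobenius / the Rayleigh
quotient — that packaging is PRINTED, not typed) and every real vector `δ`,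

  `∑_{x,y} Γ[x,y] δ_x δ_y ≤ Λ · √(c₀ c₁) · ∑_x δ_x²`

whenever every `0`-input of `f` has a certificate of size `≤ c₀` and every `1`-input one of size
`≤ c₁` (`adversary_sum_le_sqrt_certificate`; with `λ(Γ) = max_{‖δ‖=1} δᵀΓδ` this is
`λ(Γ) ≤ √(C₀ C₁) · max_i λ(Γ_i)`, i.e. `Adv(f) ≤ √(C₀(f) C₁(f))`), the coarse form
`≤ Λ · C(f) · ∑ δ²` (`adversary_sum_le_certificateComplexity`), and the promise version
`≤ Λ · √(c N) · ∑ δ²` when the `b`-inputs of the promise set carry promise-relative certificates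
of size `≤ c` (`adversary_sum_le_sqrt_certificate_partial`, both clauses of the printed `min`).

**Proof.** Not the printed route (ŠS06 prove Thm. 3.2 for the minimax quantity `MM(f)` with
de Wolf's weighting — `p_x` uniform on a minimal certificate — and transfer it to the spectral
formulation through the duality `SA = MM`, their Thm. 1.1, an SDP duality that is NOT typed here)
but a direct Cauchy–Schwarz over certificate witnesses (`CertificateBarrier.sum_le_of_covering`):
if `T_x` is a certificate of `x` then every pair with `Γ[x,y] ≠ 0` (so `f x ≠ f y`) differs at
some `i ∈ T_x ∩ T_y` («otherwise we could find an input `z` that is consistent with both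
certificates» [SpalekSzegedy2006, proof of Thm. 3.2]); so with `u^i_x = [i ∈ T_x] σ_x δ_x`
(`σ = r` on `0`-inputs, `r⁻¹` on `1`-inputs, `σ_x σ_y = 1` across every edge),
`∑ Γ δδ ≤ ∑_i u^iᵀ Γ_i u^i ≤ Λ ∑_i ‖u^i‖² = Λ ∑_x |T_x| σ_x² δ_x² ≤ Λ (c₀ r² A + c₁ r⁻² B)` with
`A + B = ∑ δ²`, and `r² = √(c₁/c₀)` gives `Λ √(c₀c₁) ∑ δ²`. Symmetry of `Γ` is not needed. No
named facts, no definitions. Not here: the weighted / relational / Kolmogorov formulations and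
their equivalence with the spectral one [SpalekSzegedy2006, Thm. 1.1] (PRINTED); the
negative-weight adversary (not subject to this ceiling); any statement about `Q₂(f)` itself.

## References

* R. Špalek, M. Szegedy, *All quantum adversary methods are equivalent*, Theory of Computing 2
  (2006) 1–18, Thm. 3.2, Cor. 3.3 (arXiv:quant-ph/0409116, pp. 6–7) [SpalekSzegedy2006].
* P. Høyer, R. Špalek, *Lower bounds on quantum query complexity*, Bull. EATCS 87 (2005), §3, §4
  Thm. 2, §6 Lemma 6 (arXiv:quant-ph/0509153) [HoyerSpalek2005].
* R. Beals, H. Buhrman, R. Cleve, M. Mosca, R. de Wolf, J. ACM 48 (2001), Def. 5.1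
  [BealsEtAl2001].
-/

namespace Literature.Computability.QuantumComplexity

open Finset

variable {N : ℕ}

namespace CertificateBarrier

/-- **Covering lemma.** Let `Γ ≥ 0`, let `Λ` bound the quadratic form of every `Γ_i` on
nonnegative vectors, let `T_x ⊆ [N]` be index sets such that every pair with `Γ[x,y] ≠ 0` differs
at some index of `T_x ∩ T_y`, and let `σ ≥ 0` be scales with `σ_x σ_y = 1` whenever `Γ[x,y] ≠ 0`.
Then for every `w ≥ 0`, `∑_{x,y} Γ[x,y] w_x w_y ≤ Λ ∑_x |T_x| σ_x² w_x²` (restrict and rescale: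
the vectors `u^i_x = [i ∈ T_x] σ_x w_x` satisfy `∑ Γ w w ≤ ∑_i u^iᵀ Γ_i u^i` and
`∑_i ‖u^i‖² = ∑_x |T_x| σ_x² w_x²`). [cite: SpalekSzegedy2006, Thm. 3.2 (proof)] -/
theorem sum_le_of_covering (Γ : (Fin N → Bool) → (Fin N → Bool) → ℝ) (hΓ0 : ∀ x y, 0 ≤ Γ x y)
    {Λ : ℝ}
    (hΛ : ∀ (i : Fin N) (v : (Fin N → Bool) → ℝ), (∀ x, 0 ≤ v x) →
      ∑ x, ∑ y, (if x i = y i then (0 : ℝ) else Γ x y) * (v x * v y) ≤ Λ * ∑ x, v x ^ 2)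
    (T : (Fin N → Bool) → Finset (Fin N))
    (hcov : ∀ x y, Γ x y ≠ 0 → ∃ i ∈ T x, i ∈ T y ∧ x i ≠ y i)
    (σ : (Fin N → Bool) → ℝ) (hσ : ∀ x, 0 ≤ σ x) (hσ1 : ∀ x y, Γ x y ≠ 0 → σ x * σ y = 1)
    (w : (Fin N → Bool) → ℝ) (hw : ∀ x, 0 ≤ w x) :
    ∑ x, ∑ y, Γ x y * (w x * w y) ≤ Λ * ∑ x, ((T x).card : ℝ) * (σ x ^ 2 * w x ^ 2) := by
  classical
  -- the scaled, certificate-restricted vectors `u^i`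
  set u : Fin N → (Fin N → Bool) → ℝ := fun i x => if i ∈ T x then σ x * w x else 0 with hu
  have hu0 : ∀ i x, 0 ≤ u i x := fun i x => by
    simp only [hu]
    split_ifs
    · exact mul_nonneg (hσ x) (hw x)
    · exact le_rfl
  have hterm0 : ∀ x y i, 0 ≤ (if x i = y i then (0 : ℝ) else Γ x y) * (u i x * u i y) :=
    fun x y i => by
      split_ifs
      · rw [zero_mul]
      · exact mul_nonneg (hΓ0 x y) (mul_nonneg (hu0 i x) (hu0 i y))
  -- (1) every term is covered by the differing certificate index
  have hterm : ∀ x y, Γ x y * (w x * w y) ≤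
      ∑ i, (if x i = y i then (0 : ℝ) else Γ x y) * (u i x * u i y) := by
    intro x y
    by_cases hxy : Γ x y = 0
    · have h0 : (0 : ℝ) ≤ ∑ i, (if x i = y i then (0 : ℝ) else Γ x y) * (u i x * u i y) :=
        Finset.sum_nonneg fun i _ => hterm0 x y i
      calc Γ x y * (w x * w y) = 0 := by rw [hxy, zero_mul]
        _ ≤ _ := h0
    · obtain ⟨j, hjx, hjy, hj⟩ := hcov x y hxy
      have hsingle : (if x j = y j then (0 : ℝ) else Γ x y) * (u j x * u j y) =
          Γ x y * (w x * w y) := by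
        rw [if_neg hj]
        simp only [hu, if_pos hjx, if_pos hjy]
        calc Γ x y * (σ x * w x * (σ y * w y)) = Γ x y * ((σ x * σ y) * (w x * w y)) := by ring
          _ = Γ x y * (w x * w y) := by rw [hσ1 x y hxy, one_mul]
      rw [← hsingle]
      exact Finset.single_le_sum (f := fun i => (if x i = y i then (0 : ℝ) else Γ x y) *
        (u i x * u i y)) (fun i _ => hterm0 x y i) (Finset.mem_univ j)
  -- (2) `∑_i ‖u^i‖² = ∑_x |T_x| σ_x² w_x²`
  have hnorm : ∀ x, ∑ i, u i x ^ 2 = ((T x).card : ℝ) * (σ x ^ 2 * w x ^ 2) := by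
    intro x
    have e : ∀ i, u i x ^ 2 = if i ∈ T x then σ x ^ 2 * w x ^ 2 else 0 := fun i => by
      simp only [hu]
      split_ifs <;> ring
    simp_rw [e]
    rw [Finset.sum_ite_mem, Finset.univ_inter, Finset.sum_const, nsmul_eq_mul]
  -- (3) sum, swap and apply the `Γ_i` bounds
  calc ∑ x, ∑ y, Γ x y * (w x * w y)
      ≤ ∑ x, ∑ y, ∑ i, (if x i = y i then (0 : ℝ) else Γ x y) * (u i x * u i y) :=
        Finset.sum_le_sum fun x _ => Finset.sum_le_sum fun y _ => hterm x y
    _ = ∑ x, ∑ i, ∑ y, (if x i = y i then (0 : ℝ) else Γ x y) * (u i x * u i y) :=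
        Finset.sum_congr rfl fun x _ => Finset.sum_comm
    _ = ∑ i, ∑ x, ∑ y, (if x i = y i then (0 : ℝ) else Γ x y) * (u i x * u i y) :=
        Finset.sum_comm
    _ ≤ ∑ i, Λ * ∑ x, u i x ^ 2 := Finset.sum_le_sum fun i _ => hΛ i (u i) (hu0 i)
    _ = Λ * ∑ x, ∑ i, u i x ^ 2 := by rw [← Finset.mul_sum, Finset.sum_comm]
    _ = Λ * ∑ x, ((T x).card : ℝ) * (σ x ^ 2 * w x ^ 2) := by
        congr 1
        exact Finset.sum_congr rfl fun x _ => hnorm x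

/-- **Two-sided packaging.** If, in the situation of `sum_le_of_covering`, `Γ` only links inputs of
different `side`, the index sets have `|T_x| ≤ c₀` on side `false` and `≤ c₁` on side `true`, and
`Λ ≥ 0`, then for EVERY real vector `δ`,
`∑_{x,y} Γ[x,y] δ_x δ_y ≤ Λ · √(c₀ c₁) · ∑_x δ_x²` (pass to `|δ|`; scales `r`, `r⁻¹` with
`r² = √(c₁/c₀)`, so that `c₀ r² = c₁ r⁻² = √(c₀ c₁)`; if `c₀ = 0` or `c₁ = 0` the covering forces
`Γ = 0`). [cite: SpalekSzegedy2006, Thm. 3.2 (proof)] -/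
theorem sum_le_sqrt_of_covering (side : (Fin N → Bool) → Bool)
    (Γ : (Fin N → Bool) → (Fin N → Bool) → ℝ) (hΓ0 : ∀ x y, 0 ≤ Γ x y)
    (hside : ∀ x y, Γ x y ≠ 0 → side x ≠ side y)
    {Λ : ℝ} (hΛ0 : 0 ≤ Λ)
    (hΛ : ∀ (i : Fin N) (v : (Fin N → Bool) → ℝ), (∀ x, 0 ≤ v x) →
      ∑ x, ∑ y, (if x i = y i then (0 : ℝ) else Γ x y) * (v x * v y) ≤ Λ * ∑ x, v x ^ 2)
    (T : (Fin N → Bool) → Finset (Fin N))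
    (hcov : ∀ x y, Γ x y ≠ 0 → ∃ i ∈ T x, i ∈ T y ∧ x i ≠ y i)
    {c₀ c₁ : ℕ} (hT0 : ∀ x, side x = false → (T x).card ≤ c₀)
    (hT1 : ∀ x, side x = true → (T x).card ≤ c₁)
    (δ : (Fin N → Bool) → ℝ) :
    ∑ x, ∑ y, Γ x y * (δ x * δ y) ≤ Λ * Real.sqrt (c₀ * c₁) * ∑ x, δ x ^ 2 := by
  classical
  -- pass to `w = |δ|`
  have hred : ∑ x, ∑ y, Γ x y * (δ x * δ y) ≤ ∑ x, ∑ y, Γ x y * (|δ x| * |δ y|) :=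
    Finset.sum_le_sum fun x _ => Finset.sum_le_sum fun y _ =>
      mul_le_mul_of_nonneg_left (by rw [← abs_mul]; exact le_abs_self _) (hΓ0 x y)
  refine hred.trans ?_
  have hw2 : ∀ x, |δ x| ^ 2 = δ x ^ 2 := fun x => sq_abs _
  by_cases hc : c₀ = 0 ∨ c₁ = 0
  · -- degenerate sizes: an endpoint of every edge has an empty index set, so `Γ = 0`
    have hΓ : ∀ x y, Γ x y = 0 := by
      intro x y
      by_contra h
      obtain ⟨i, hix, hiy, -⟩ := hcov x y h
      have hs := hside x y h
      have hT : ∀ z, i ∈ T z → (side z = false → c₀ ≠ 0) ∧ (side z = true → c₁ ≠ 0) := by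
        intro z hiz
        refine ⟨fun hz h0 => ?_, fun hz h1 => ?_⟩
        · have hcard := hT0 z hz
          rw [h0, Nat.le_zero, Finset.card_eq_zero] at hcard
          simp [hcard] at hiz
        · have hcard := hT1 z hz
          rw [h1, Nat.le_zero, Finset.card_eq_zero] at hcard
          simp [hcard] at hiz
      rcases hc with h0 | h1
      · cases hx : side x
        · exact (hT x hix).1 hx h0
        · cases hy : side y
          · exact (hT y hiy).1 hy h0
          · exact hs (hx.trans hy.symm)
      · cases hx : side x
        · cases hy : side y
          · exact hs (hx.trans hy.symm)
          · exact (hT y hiy).2 hy h1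
        · exact (hT x hix).2 hx h1
    simp only [hΓ, zero_mul, Finset.sum_const_zero]
    exact mul_nonneg (mul_nonneg hΛ0 (Real.sqrt_nonneg _))
      (Finset.sum_nonneg fun x _ => sq_nonneg _)
  · push Not at hc
    obtain ⟨hc0, hc1⟩ := hc
    have hc0' : (0 : ℝ) < c₀ := by exact_mod_cast Nat.pos_of_ne_zero hc0
    have hc1' : (0 : ℝ) < c₁ := by exact_mod_cast Nat.pos_of_ne_zero hc1
    -- the scale `r`, `r² = √c₁ / √c₀`
    set r : ℝ := Real.sqrt (Real.sqrt c₁ / Real.sqrt c₀) with hr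
    have hr0 : 0 < r :=
      Real.sqrt_pos.2 (div_pos (Real.sqrt_pos.2 hc1') (Real.sqrt_pos.2 hc0'))
    have hr2 : r ^ 2 = Real.sqrt c₁ / Real.sqrt c₀ :=
      Real.sq_sqrt (div_nonneg (Real.sqrt_nonneg _) (Real.sqrt_nonneg _))
    have hsq : Real.sqrt ((c₀ : ℝ) * c₁) = Real.sqrt c₀ * Real.sqrt c₁ :=
      Real.sqrt_mul (Nat.cast_nonneg _) _
    have hside0 : (c₀ : ℝ) * r ^ 2 = Real.sqrt (c₀ * c₁) := by
      rw [hr2, hsq]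
      calc (c₀ : ℝ) * (Real.sqrt c₁ / Real.sqrt c₀) = (c₀ / Real.sqrt c₀) * Real.sqrt c₁ := by ring
        _ = Real.sqrt c₀ * Real.sqrt c₁ := by rw [Real.div_sqrt]
    have hside1 : (c₁ : ℝ) * r⁻¹ ^ 2 = Real.sqrt (c₀ * c₁) := by
      rw [inv_pow, hr2, inv_div, hsq]
      calc (c₁ : ℝ) * (Real.sqrt c₀ / Real.sqrt c₁) = Real.sqrt c₀ * (c₁ / Real.sqrt c₁) := by ring
        _ = Real.sqrt c₀ * Real.sqrt c₁ := by rw [Real.div_sqrt]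
    -- the two-valued scale
    set σ : (Fin N → Bool) → ℝ := fun x => if side x = false then r else r⁻¹ with hσdef
    have hσ : ∀ x, 0 ≤ σ x := fun x => by
      simp only [hσdef]
      split_ifs
      · exact hr0.le
      · exact inv_nonneg.2 hr0.le
    have hσ1 : ∀ x y, Γ x y ≠ 0 → σ x * σ y = 1 := by
      intro x y h
      have hs := hside x y h
      simp only [hσdef]
      cases hx : side x <;> cases hy : side y
      · exact absurd (hx.trans hy.symm) hs
      · simp [hr0.ne']
      · simp [hr0.ne']
      · exact absurd (hx.trans hy.symm) hs
    have key := sum_le_of_covering Γ hΓ0 hΛ T hcov σ hσ hσ1 (fun x => |δ x|)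
      (fun x => abs_nonneg _)
    -- `|T_x| σ_x² ≤ √(c₀ c₁)` on both sides
    have hcard : ∀ x, ((T x).card : ℝ) * (σ x ^ 2 * |δ x| ^ 2) ≤
        Real.sqrt (c₀ * c₁) * δ x ^ 2 := by
      intro x
      rw [← mul_assoc, hw2]
      refine mul_le_mul_of_nonneg_right ?_ (sq_nonneg _)
      simp only [hσdef]
      cases hx : side x
      · rw [if_pos rfl, ← hside0]
        exact mul_le_mul_of_nonneg_right (by exact_mod_cast hT0 x hx) (sq_nonneg _)
      · rw [if_neg (by decide), ← hside1]
        exact mul_le_mul_of_nonneg_right (by exact_mod_cast hT1 x hx) (sq_nonneg _)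
    calc ∑ x, ∑ y, Γ x y * (|δ x| * |δ y|)
        ≤ Λ * ∑ x, ((T x).card : ℝ) * (σ x ^ 2 * |δ x| ^ 2) := key
      _ ≤ Λ * ∑ x, Real.sqrt (c₀ * c₁) * δ x ^ 2 :=
          mul_le_mul_of_nonneg_left (Finset.sum_le_sum fun x _ => hcard x) hΛ0
      _ = Λ * Real.sqrt (c₀ * c₁) * ∑ x, δ x ^ 2 := by rw [← Finset.mul_sum, mul_assoc]

end CertificateBarrier

open CertificateBarrier

/-- **The certificate ceiling of the spectral adversary method, total functions** (Špalek–Szegedy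
Thm. 3.2 / Cor. 3.3; Høyer–Špalek Lemma 6: «if `F` is total, the method is limited by
`√(C₀(F) C₁(F))`»), Rayleigh form. Let `f` be a total Boolean function, `Γ ≥ 0` a weight on pairs
of inputs vanishing unless `f x ≠ f y` (a spectral adversary matrix; symmetry is not needed), and
`Λ ≥ 0` a bound for the quadratic forms of all `Γ_i = Γ ∘ D_i` on nonnegative vectors
(`Λ ≥ max_i λ(Γ_i)`). If every `0`-input has certificate complexity `C_x(f) ≤ c₀` and every
`1`-input `C_x(f) ≤ c₁`, then for every real `δ`,
`∑_{x,y} Γ[x,y] δ_x δ_y ≤ Λ · √(c₀ c₁) · ∑_x δ_x²`; on unit `δ` this reads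
`λ(Γ) ≤ √(c₀ c₁) · max_i λ(Γ_i)`, i.e. `Adv(f) ≤ √(C₀(f) C₁(f))`.
[cite: SpalekSzegedy2006, Thm. 3.2 and Cor. 3.3] [cite: HoyerSpalek2005, Lemma 6] -/
theorem adversary_sum_le_sqrt_certificate (f : (Fin N → Bool) → Bool)
    (Γ : (Fin N → Bool) → (Fin N → Bool) → ℝ) (hΓ0 : ∀ x y, 0 ≤ Γ x y)
    (hΓf : ∀ x y, Γ x y ≠ 0 → f x ≠ f y)
    {Λ : ℝ} (hΛ0 : 0 ≤ Λ)
    (hΛ : ∀ (i : Fin N) (v : (Fin N → Bool) → ℝ), (∀ x, 0 ≤ v x) →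
      ∑ x, ∑ y, (if x i = y i then (0 : ℝ) else Γ x y) * (v x * v y) ≤ Λ * ∑ x, v x ^ 2)
    {c₀ c₁ : ℕ} (hc₀ : ∀ x, f x = false → Complexity.certificateComplexityAt f x ≤ c₀)
    (hc₁ : ∀ x, f x = true → Complexity.certificateComplexityAt f x ≤ c₁)
    (δ : (Fin N → Bool) → ℝ) :
    ∑ x, ∑ y, Γ x y * (δ x * δ y) ≤ Λ * Real.sqrt (c₀ * c₁) * ∑ x, δ x ^ 2 := by
  classical
  -- minimal certificates `S_x`, `|S_x| = C_x(f)`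
  choose S hS hScard using fun x => Complexity.exists_certificate_card_eq f x
  refine sum_le_sqrt_of_covering f Γ hΓ0 hΓf hΛ0 hΛ S ?_
    (fun x hx => (hScard x).le.trans (hc₀ x hx)) (fun x hx => (hScard x).le.trans (hc₁ x hx)) δ
  -- two certificates of inputs with different values clash inside their intersection:
  -- «otherwise we could find an input `z` that is consistent with both certificates»
  intro x y hxy
  by_contra h
  push Not at h
  let z : Fin N → Bool := fun i => if i ∈ S x then x i else y i
  have hzx : f z = f x := hS x z fun i hi => by simp [z, hi]
  have hzy : f z = f y := hS y z fun i hi => by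
    by_cases hix : i ∈ S x
    · simp only [z, if_pos hix]
      exact h i hix hi
    · simp [z, hix]
  exact hΓf x y hxy (hzx.symm.trans hzy)

/-- **Coarse form `Adv(f) ≤ C(f)`**: with `c₀ = c₁ = C(f)` (`certificateComplexity`),
`∑_{x,y} Γ[x,y] δ_x δ_y ≤ Λ · C(f) · ∑_x δ_x²` — «this corollary rules out all adversary attempts to
prove good lower bounds for problems with small certificate complexity, such as element distinctness
…, triangle finding, or verification of matrix products». [cite: SpalekSzegedy2006, Cor. 3.3] -/
theorem adversary_sum_le_certificateComplexity (f : (Fin N → Bool) → Bool)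
    (Γ : (Fin N → Bool) → (Fin N → Bool) → ℝ) (hΓ0 : ∀ x y, 0 ≤ Γ x y)
    (hΓf : ∀ x y, Γ x y ≠ 0 → f x ≠ f y)
    {Λ : ℝ} (hΛ0 : 0 ≤ Λ)
    (hΛ : ∀ (i : Fin N) (v : (Fin N → Bool) → ℝ), (∀ x, 0 ≤ v x) →
      ∑ x, ∑ y, (if x i = y i then (0 : ℝ) else Γ x y) * (v x * v y) ≤ Λ * ∑ x, v x ^ 2)
    (δ : (Fin N → Bool) → ℝ) :
    ∑ x, ∑ y, Γ x y * (δ x * δ y) ≤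
      Λ * (Complexity.certificateComplexity f : ℝ) * ∑ x, δ x ^ 2 := by
  have h := adversary_sum_le_sqrt_certificate f Γ hΓ0 hΓf hΛ0 hΛ
    (c₀ := Complexity.certificateComplexity f) (c₁ := Complexity.certificateComplexity f)
    (fun x _ => Complexity.certificateComplexityAt_le f x)
    (fun x _ => Complexity.certificateComplexityAt_le f x) δ
  rwa [Real.sqrt_mul_self (Nat.cast_nonneg _)] at h

/-- **The printed two-sided form** with the tree's maxima: `C₁(f) = oneCertificateComplexity f` and
`C₀(f) = max_{x : f x = 0} C_x(f)` (written as a `Finset.sup`, the tree having no separate name for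
it): `∑_{x,y} Γ[x,y] δ_x δ_y ≤ Λ · √(C₀(f) C₁(f)) · ∑_x δ_x²`.
[cite: HoyerSpalek2005, Lemma 6] [cite: SpalekSzegedy2006, Cor. 3.3] -/
theorem adversary_sum_le_sqrt_zero_one_certificate (f : (Fin N → Bool) → Bool)
    (Γ : (Fin N → Bool) → (Fin N → Bool) → ℝ) (hΓ0 : ∀ x y, 0 ≤ Γ x y)
    (hΓf : ∀ x y, Γ x y ≠ 0 → f x ≠ f y)
    {Λ : ℝ} (hΛ0 : 0 ≤ Λ)
    (hΛ : ∀ (i : Fin N) (v : (Fin N → Bool) → ℝ), (∀ x, 0 ≤ v x) →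
      ∑ x, ∑ y, (if x i = y i then (0 : ℝ) else Γ x y) * (v x * v y) ≤ Λ * ∑ x, v x ^ 2)
    (δ : (Fin N → Bool) → ℝ) :
    ∑ x, ∑ y, Γ x y * (δ x * δ y) ≤
      Λ * Real.sqrt (((Finset.univ.filter fun x => f x = false).sup
          (Complexity.certificateComplexityAt f) : ℕ) *
            (Complexity.oneCertificateComplexity f : ℕ)) * ∑ x, δ x ^ 2 := by
  classical
  refine adversary_sum_le_sqrt_certificate f Γ hΓ0 hΓf hΛ0 hΛ (fun x hx => ?_)
    (fun x hx => Complexity.certificateComplexityAt_le_one hx) δ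
  exact Finset.le_sup (f := Complexity.certificateComplexityAt f) (by simpa using hx)

/-- **The certificate ceiling, promise version** (Høyer–Špalek Lemma 6, first clause: «Let
`F : S → {0,1}` be any partial boolean function. The spectral adversary lower bound `Adv(F)` is at
most `min{√(C₀(F)N), √(C₁(F)N)}`»; Špalek–Szegedy Thm. 3.2 / Cor. 3.3, partial case). Let `Γ ≥ 0`
link only inputs of the promise set `D` with different `f`-values, `Λ ≥ 0` bound all `Γ_i` as above,
and suppose every `x ∈ D` with `f x = b` has a promise-relative certificate of size `≤ c` (a set `S`
of `≤ c` positions such that every `y ∈ D` agreeing with `x` on `S` has `f y = f x`). Then for every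
real `δ`, `∑_{x,y} Γ[x,y] δ_x δ_y ≤ Λ · √(c N) · ∑_x δ_x²` (`b = false`: `√(C₀ N)`; `b = true`:
`√(C₁ N)`; the other side is covered by the full index set `[N]`).
[cite: HoyerSpalek2005, Lemma 6] [cite: SpalekSzegedy2006, Thm. 3.2 and Cor. 3.3] -/
theorem adversary_sum_le_sqrt_certificate_partial (f : (Fin N → Bool) → Bool)
    (D : Set (Fin N → Bool)) (b : Bool)
    (Γ : (Fin N → Bool) → (Fin N → Bool) → ℝ) (hΓ0 : ∀ x y, 0 ≤ Γ x y)
    (hΓD : ∀ x y, Γ x y ≠ 0 → x ∈ D ∧ y ∈ D ∧ f x ≠ f y)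
    {Λ : ℝ} (hΛ0 : 0 ≤ Λ)
    (hΛ : ∀ (i : Fin N) (v : (Fin N → Bool) → ℝ), (∀ x, 0 ≤ v x) →
      ∑ x, ∑ y, (if x i = y i then (0 : ℝ) else Γ x y) * (v x * v y) ≤ Λ * ∑ x, v x ^ 2)
    {c : ℕ}
    (hc : ∀ x ∈ D, f x = b → ∃ S : Finset (Fin N), S.card ≤ c ∧
      ∀ y ∈ D, (∀ i ∈ S, y i = x i) → f y = f x)
    (δ : (Fin N → Bool) → ℝ) :
    ∑ x, ∑ y, Γ x y * (δ x * δ y) ≤ Λ * Real.sqrt (c * N) * ∑ x, δ x ^ 2 := by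
  classical
  -- promise-relative certificates on the `b`-side of `D`, the full index set elsewhere
  have hc' : ∀ x, ∃ S : Finset (Fin N), (x ∈ D ∧ f x = b → S.card ≤ c ∧
      ∀ y ∈ D, (∀ i ∈ S, y i = x i) → f y = f x) := by
    intro x
    by_cases hx : x ∈ D ∧ f x = b
    · obtain ⟨S, hS⟩ := hc x hx.1 hx.2
      exact ⟨S, fun _ => hS⟩
    · exact ⟨∅, fun h => absurd h hx⟩
  choose S hS using hc'
  let side : (Fin N → Bool) → Bool := fun x => decide ¬(x ∈ D ∧ f x = b)
  let T : (Fin N → Bool) → Finset (Fin N) := fun x => if x ∈ D ∧ f x = b then S x else Finset.univ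
  have hT_small : ∀ x, x ∈ D ∧ f x = b → T x = S x := fun x hx => if_pos hx
  have hT_big : ∀ x, ¬(x ∈ D ∧ f x = b) → T x = Finset.univ := fun x hx => if_neg hx
  -- every edge has exactly one endpoint on the `b`-side of `D`
  have hsplit : ∀ x y, Γ x y ≠ 0 →
      ((x ∈ D ∧ f x = b) ∧ ¬(y ∈ D ∧ f y = b)) ∨ (¬(x ∈ D ∧ f x = b) ∧ (y ∈ D ∧ f y = b)) := by
    intro x y h
    obtain ⟨hxD, hyD, hne⟩ := hΓD x y h
    cases hfx : f x <;> cases hfy : f y <;> cases b <;> simp_all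
  have hside : ∀ x y, Γ x y ≠ 0 → side x ≠ side y := fun x y h => by
    rcases hsplit x y h with ⟨hx, hy⟩ | ⟨hx, hy⟩ <;> simp [side, hx, hy]
  -- covering: the certificate of the `b`-side endpoint contains a differing index
  have hclash : ∀ x y, x ∈ D ∧ f x = b → y ∈ D → f x ≠ f y → ∃ i ∈ S x, x i ≠ y i := by
    intro x y hx hyD hne
    by_contra hall
    push Not at hall
    exact hne ((hS x hx).2 y hyD fun i hi => (hall i hi).symm).symm
  have hcov : ∀ x y, Γ x y ≠ 0 → ∃ i ∈ T x, i ∈ T y ∧ x i ≠ y i := by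
    intro x y h
    obtain ⟨hxD, hyD, hne⟩ := hΓD x y h
    rcases hsplit x y h with ⟨hx, hy⟩ | ⟨hx, hy⟩
    · obtain ⟨i, hi, hne'⟩ := hclash x y hx hyD hne
      exact ⟨i, by rw [hT_small x hx]; exact hi, by rw [hT_big y hy]; exact Finset.mem_univ i, hne'⟩
    · obtain ⟨i, hi, hne'⟩ := hclash y x hy hxD (Ne.symm hne)
      exact ⟨i, by rw [hT_big x hx]; exact Finset.mem_univ i, by rw [hT_small y hy]; exact hi,
        fun e => hne' e.symm⟩
  have hT0 : ∀ x, side x = false → (T x).card ≤ c := by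
    intro x hx
    have hx' : x ∈ D ∧ f x = b := by simpa [side] using hx
    rw [hT_small x hx']
    exact (hS x hx').1
  have hT1 : ∀ x, side x = true → (T x).card ≤ N := fun x _ =>
    (Finset.card_le_univ _).trans (Fintype.card_fin N).le
  exact sum_le_sqrt_of_covering side Γ hΓ0 hside hΛ0 hΛ T hcov hT0 hT1 δ

end Literature.Computability.QuantumComplexity
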